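import Literature.MathematicalPhysics.QuantumLattice.HubbardTorusPlaquetteDressedBound
import Literature.MathematicalPhysics.QuantumLattice.HartreeFockSDWTorus
import Literature.MathematicalPhysics.QuantumLattice.HubbardTorus2DEnergyDensity
import Literature.MathematicalPhysics.QuantumLattice.FockRelabel
import HarnessLib

/-!
# The plaquette local-unitary-cluster (LUC) upper bound: antiferromagnetic Hartree–Fock state dressed by one plaquette unitary

Topic `MathematicalPhysics/QuantumLattice`, family `hubbard`; specialisation of
`HubbardTorusPlaquetteDressedBound.lean` (`PlaquetteLUC.groundEnergyAt_le_dressed`) to the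
spin-density-wave Slater projection `sdwState` of `HartreeFockSDWTorus.lean` and ONE plaquette
unitary `u` repeated over all plaquettes, and the passage to the thermodynamic limit:

* `siteTranslate v` — the translation `x ↦ x + v` of the fermionic torus; translation invariance of
  the hopping matrix and of every `conjDiag f` (`W diag f Wᴴ`), invariance of the staggering matrix
  under EVEN translations (`L` even), hence `sdwProj`/`sdwState` are invariant under even
  translations (`sdwState_submatrix_translate_two_nsmul`);
* `cellSite_add`, `linkSite_add` — moving to the plaquette `c + v` is the even translation by `2v`;
  hence the window blocks of `sdwState` on the plaquette `c` and on the link `(c, e)` do not depend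
  on `c` (`sdwState_cellBlock_eq`, `sdwState_linkBlock_eq`);
* `groundEnergyAt_le_luc` — **the LUC bound on the torus**: for `M ≥ 2`, real `t, U`, `Δ ≠ 0` and a
  particle-number conserving plaquette unitary `u`,
  `E_{(ℤ/2M)²}(t,U; 4M²) ≤ M² · Re F`, `F = F_cell + F_link,0 + F_link,1` the three window
  contractions at the plaquette `c = 0` (explicit polynomials in the window entries of `sdwState`
  and the entries of `u`);
* `energyDensity2D_le_luc` — **thermodynamic limit**: for `U ≥ 0`,
  `e(t,U; ρ = 1) ≤ Re F / 4 + 8|t|/M` for every `M ≥ 2` (`ThermodynamicLimit.energyDensity2D_le`,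
  tiling bound `+16|t|/L` at `L = 2M`).

This is the kernel-checked form of the "plaquette-LUC" thermodynamic-limit upper bounds on the
half-filled square-lattice Hubbard energy density: what remains to be evaluated (in exact or ball
arithmetic) is the finite expression `F` — `2⁸`- and `2¹⁶`-dimensional window contractions against
`slaterRDM` of the `8`- and `16`-orbital window blocks of `sdwState`, themselves finite momentum sums
(`sdwR = W diag(E_k⁻¹) Wᴴ`). Sources: Bach–Lieb–Solovej 1994 [BachLiebSolovej1994] (variational
principle, quasi-free states); Langer–Mattis 1971 [LangerMattis1971] (the SDW state); Ruelle 1969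
§3.3 [Ruelle1969] (tiling). Everything is proved; the one definition (`siteTranslate`) is an
abbreviation; no named facts.
-/

noncomputable section

namespace Literature.MathematicalPhysics.QuantumLattice

open Matrix Finset HubbardWave0 Literature.Probability.LatticeModels LangerMattis
open scoped ComplexOrder ComplexConjugate

/-! ### §1. Translations of the fermionic torus and translation-invariant one-body matrices -/

section Translate

variable {d L : ℕ} [NeZero L]

/-- The translation `x ↦ x + v` of the fermionic torus (sites compared in `(ℤ/L)^d`). [folklore] -/
abbrev siteTranslate (v : TorusSite d L) : FermionTorus d L ≃ FermionTorus d L :=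
  FermionTorus.ofTorusEquiv (Equiv.addRight v)

/-- `(x + v)` in torus coordinates. [folklore] -/
@[simp] theorem toTorusSite_siteTranslate (v : TorusSite d L) (x : FermionTorus d L) :
    FermionTorus.toTorusSite (siteTranslate v x) = FermionTorus.toTorusSite x + v := by
  rw [siteTranslate, FermionTorus.ofTorusEquiv_apply, FermionTorus.toTorusSite_ofTorusSite, Equiv.coe_addRight]

/-- Two sites with translated torus coordinates. [folklore] -/
theorem eq_siteTranslate_of_toTorusSite_eq {v : TorusSite d L} {x y : FermionTorus d L}
    (h : FermionTorus.toTorusSite y = FermionTorus.toTorusSite x + v) : y = siteTranslate v x := by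
  apply FermionTorus.equivTorusSite.injective
  change FermionTorus.toTorusSite y = FermionTorus.toTorusSite (siteTranslate v x)
  rw [toTorusSite_siteTranslate, h]

/-- **Nearest-neighbour adjacency is translation invariant.** [folklore] -/
theorem fermionTorusGraph_adj_siteTranslate (v : TorusSite d L) (x y : FermionTorus d L) :
    (fermionTorusGraph d L).Adj (siteTranslate v x) (siteTranslate v y) ↔ (fermionTorusGraph d L).Adj x y := by
  simp only [fermionTorusGraph_adj, torusGraph_adj_iff, toTorusSite_siteTranslate]
  refine and_congr (not_congr (add_left_inj v)) (or_congr (exists_congr fun i => ?_) (exists_congr fun i => ?_))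
  · rw [add_right_comm, add_left_inj]
  · rw [add_right_comm, add_left_inj]

/-- The hopping matrix is translation invariant. [folklore] -/
theorem hopMatrix_submatrix_siteTranslate (v : TorusSite d L) (t : ℝ) :
    (hopMatrix (fermionTorusGraph d L) t).submatrix (siteTranslate v) (siteTranslate v) =
      hopMatrix (fermionTorusGraph d L) t := by
  ext x y
  simp only [submatrix_apply, hopMatrix, Matrix.of_apply, fermionTorusGraph_adj_siteTranslate]

/-- `W diag(f) Wᴴ` is translation invariant (its entries depend on `x - y` only). [folklore] -/
theorem conjDiag_submatrix_siteTranslate (v : TorusSite d L) (f : FermionTorus d L → ℂ) :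
    (HartreeFock.conjDiag d L f).submatrix (siteTranslate v) (siteTranslate v) = HartreeFock.conjDiag d L f := by
  ext x y
  rw [submatrix_apply, HartreeFock.conjDiag, Matrix.mul_apply, Matrix.mul_apply]
  refine Finset.sum_congr rfl fun k _ => ?_
  rw [mul_diagonal, mul_diagonal, conjTranspose_apply, conjTranspose_apply]
  simp only [sitePlaneWave, Matrix.of_apply, toTorusSite_siteTranslate, torusChar_add_right, star_mul']
  have h1 : torusChar k.toTorusSite v * star (torusChar k.toTorusSite v) = 1 := by
    rw [Complex.star_def]; exact torusChar_mul_conj _ _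
  calc torusFourierWeight d L * (torusChar k.toTorusSite x.toTorusSite * torusChar k.toTorusSite v) * f k *
        (star (torusFourierWeight d L) * (star (torusChar k.toTorusSite y.toTorusSite) * star (torusChar k.toTorusSite v)))
      = torusFourierWeight d L * torusChar k.toTorusSite x.toTorusSite * f k *
          (star (torusFourierWeight d L) * star (torusChar k.toTorusSite y.toTorusSite)) *
          (torusChar k.toTorusSite v * star (torusChar k.toTorusSite v)) := by ring
    _ = _ := by rw [h1, mul_one]

omit [NeZero L] in
/-- **Even translations preserve the staggering sign** (`L` even): if `y ≡ x + 2w` then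
`(-1)^{Σ yᵢ} = (-1)^{Σ xᵢ}`. [folklore] -/
theorem torusStagger_of_toTorusSite_eq_add_two_nsmul (hL : Even L) {x y : FermionTorus d L} {w : TorusSite d L}
    (h : FermionTorus.toTorusSite y = FermionTorus.toTorusSite x + 2 • w) : torusStagger y = torusStagger x := by
  have h2 : 2 ∣ L := even_iff_two_dvd.1 hL
  have hsum : ∑ j, ((ofLex y j : ℕ) : ZMod 2) = ∑ j, ((ofLex x j : ℕ) : ZMod 2) := by
    have := congrArg (fun u : TorusSite d L => ZMod.castHom h2 (ZMod 2) (∑ j, u j)) h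
    simp only [FermionTorus.toTorusSite_apply, Pi.add_apply, Pi.smul_apply, sum_add_distrib, map_add, map_sum,
      map_natCast, map_nsmul] at this
    rw [this]
    have h0 : ∀ z : ZMod 2, 2 • z = 0 := by decide
    simp [h0]
  have key : (∑ j, (ofLex y j : ℕ)) % 2 = (∑ j, (ofLex x j : ℕ)) % 2 := by
    apply (ZMod.natCast_eq_natCast_iff' _ _ 2).1
    push_cast
    exact hsum
  have hmod : ∀ (u : ℤˣ) (n : ℕ), u ^ n = u ^ (n % 2) := fun u n => Int.units_pow_eq_pow_mod_two u n
  rw [torusStagger_apply, torusStagger_apply, hmod, key, ← hmod]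

/-- The staggering matrix is invariant under even translations (`L` even). [folklore] -/
theorem stagMatrix_submatrix_siteTranslate_two_nsmul (hL : Even L) (w : TorusSite d L) :
    (HartreeFock.stagMatrix d L).submatrix (siteTranslate (2 • w)) (siteTranslate (2 • w)) =
      HartreeFock.stagMatrix d L := by
  ext x y
  rw [submatrix_apply, HartreeFock.stagMatrix, diagonal_apply, diagonal_apply]
  simp only [EmbeddingLike.apply_eq_iff_eq]
  split_ifs with h
  · rw [torusStagger_of_toTorusSite_eq_add_two_nsmul hL (toTorusSite_siteTranslate (2 • w) x)]
  · rfl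

/-- The SDW resolvent `R` is translation invariant. [folklore] -/
theorem sdwR_submatrix_siteTranslate (v : TorusSite d L) (t Δ : ℝ) :
    (HartreeFock.sdwR d L t Δ).submatrix (siteTranslate v) (siteTranslate v) = HartreeFock.sdwR d L t Δ :=
  conjDiag_submatrix_siteTranslate v _

/-- The SDW one-body Hamiltonian `h_s = K + sΔS` is invariant under even translations. [folklore] -/
theorem sdwH_submatrix_siteTranslate_two_nsmul (hL : Even L) (w : TorusSite d L) (t Δ s : ℝ) :
    (HartreeFock.sdwH d L t Δ s).submatrix (siteTranslate (2 • w)) (siteTranslate (2 • w)) =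
      HartreeFock.sdwH d L t Δ s := by
  rw [HartreeFock.sdwH, submatrix_add, submatrix_smul, Pi.add_apply, Pi.add_apply, Pi.smul_apply,
    Pi.smul_apply, hopMatrix_submatrix_siteTranslate, stagMatrix_submatrix_siteTranslate_two_nsmul hL]

/-- **The SDW band projections are invariant under even translations.** [folklore] -/
theorem sdwProj_submatrix_siteTranslate_two_nsmul (hL : Even L) (w : TorusSite d L) (t Δ s : ℝ) :
    (HartreeFock.sdwProj d L t Δ s).submatrix (siteTranslate (2 • w)) (siteTranslate (2 • w)) =
      HartreeFock.sdwProj d L t Δ s := by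
  rw [HartreeFock.sdwProj, submatrix_smul, submatrix_sub, Pi.smul_apply, Pi.smul_apply, Pi.sub_apply,
    Pi.sub_apply, submatrix_one_equiv,
    ← submatrix_mul_equiv (HartreeFock.sdwH d L t Δ s) (HartreeFock.sdwR d L t Δ) _ (siteTranslate (2 • w)) _,
    sdwH_submatrix_siteTranslate_two_nsmul hL, sdwR_submatrix_siteTranslate]

/-- **The SDW one-particle density matrix is invariant under even translations**:
`γ((x+2w,σ),(y+2w,τ)) = γ((x,σ),(y,τ))`. [folklore] -/
theorem sdwState_orb_siteTranslate_two_nsmul (hL : Even L) (w : TorusSite d L) (t Δ : ℝ)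
    (x y : FermionTorus d L) (σ τ : Fin 2) :
    HartreeFock.sdwState d L t Δ (orb (siteTranslate (2 • w) x) σ) (orb (siteTranslate (2 • w) y) τ) =
      HartreeFock.sdwState d L t Δ (orb x σ) (orb y τ) := by
  rw [HartreeFock.sdwState, HartreeFock.spinBlock_orb, HartreeFock.spinBlock_orb]
  split_ifs with h
  · have := congrFun (congrFun (sdwProj_submatrix_siteTranslate_two_nsmul hL w (-t) Δ (HartreeFock.sdwSpin σ)) x) y
    rw [submatrix_apply] at this
    exact this
  · rfl

end Translate

/-! ### §2. The window blocks of the SDW state do not depend on the plaquette -/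

namespace PlaquetteLUC

variable {M : ℕ} [NeZero M]

omit [NeZero M] in
/-- The even translation vector `2v` of `(ℤ/2M)²` attached to a plaquette displacement `v ∈ (ℤ/M)²`.
[folklore] -/
theorem toTorusSite_cellSite_add (c v : Fin 2 → Fin M) (a : FermionTorus 2 2) :
    FermionTorus.toTorusSite (cellSite (c + v) a) =
      FermionTorus.toTorusSite (cellSite c a) + 2 • (fun i => ((v i : ℕ) : ZMod (M * 2))) := by
  funext i
  rw [Pi.add_apply, toTorusSite_cellSite, toTorusSite_cellSite, Pi.smul_apply]
  simp only [finProdFinEquiv_apply_val, Pi.add_apply, Fin.val_add, nsmul_eq_mul]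
  push_cast
  have hM : ((M * 2 : ℕ) : ZMod (M * 2)) = 0 := ZMod.natCast_self _
  -- `2 ((c + v) mod M) ≡ 2c + 2v (mod 2M)`
  have key : ((2 * (((c i : ℕ) + (v i : ℕ)) % M) : ℕ) : ZMod (M * 2)) = ((2 * ((c i : ℕ) + (v i : ℕ)) : ℕ) : ZMod (M * 2)) := by
    rw [ZMod.natCast_eq_natCast_iff', ← Nat.mul_mod_mul_left, Nat.mul_comm M 2, Nat.mod_mod]
  have key' : (2 : ZMod (M * 2)) * ((((c i : ℕ) + (v i : ℕ)) % M : ℕ) : ZMod (M * 2)) =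
      2 * ((c i : ℕ) + (v i : ℕ) : ZMod (M * 2)) := by
    have := key
    push_cast at this
    exact this
  rw [key']
  ring

/-- Moving to the plaquette `c + v` is the even translation by `2v`. [folklore] -/
theorem cellSite_add (c v : Fin 2 → Fin M) (a : FermionTorus 2 2) :
    cellSite (c + v) a = siteTranslate (2 • fun i => ((v i : ℕ) : ZMod (M * 2))) (cellSite c a) :=
  eq_siteTranslate_of_toTorusSite_eq (toTorusSite_cellSite_add c v a)

/-- `shiftCell (c + v) e = shiftCell c e + v`. [folklore] -/
theorem shiftCell_add (c v : Fin 2 → Fin M) (e : Fin 2) : shiftCell (c + v) e = shiftCell c e + v := by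
  rw [shiftCell, shiftCell, add_right_comm]

/-- Moving a link window to `c + v` is the even translation by `2v`. [folklore] -/
theorem linkSite_add (hM : 2 ≤ M) (c v : Fin 2 → Fin M) (e : Fin 2) (p : Fin 2 ×ₗ FermionTorus 2 2) :
    linkEmb hM (c + v) e p = siteTranslate (2 • fun i => ((v i : ℕ) : ZMod (M * 2))) (linkEmb hM c e p) := by
  rw [linkEmb_apply, linkEmb_apply]
  by_cases hp : (ofLex p).1 = 0
  · rw [if_pos hp, if_pos hp]; exact cellSite_add c v _
  · rw [if_neg hp, if_neg hp, shiftCell_add]; exact cellSite_add _ v _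

/-- **The plaquette blocks of the SDW state are all equal.** [folklore] -/
theorem sdwState_cellBlock_eq (t Δ : ℝ) (c : Fin 2 → Fin M) :
    (HartreeFock.sdwState 2 (M * 2) t Δ).submatrix (fun a : Orb (FermionTorus 2 2) => orb (cellEmb c (ofLex a).1) (ofLex a).2)
        (fun a : Orb (FermionTorus 2 2) => orb (cellEmb c (ofLex a).1) (ofLex a).2) =
      (HartreeFock.sdwState 2 (M * 2) t Δ).submatrix (fun a : Orb (FermionTorus 2 2) => orb (cellEmb 0 (ofLex a).1) (ofLex a).2)
        (fun a : Orb (FermionTorus 2 2) => orb (cellEmb 0 (ofLex a).1) (ofLex a).2) := by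
  have hL : Even (M * 2) := ⟨M, (Nat.mul_two M)⟩
  ext a b
  simp only [submatrix_apply, cellEmb_apply]
  rw [show c = 0 + c from (zero_add c).symm, cellSite_add, cellSite_add,
    sdwState_orb_siteTranslate_two_nsmul hL]

/-- **The link blocks of the SDW state depend only on the direction.** [folklore] -/
theorem sdwState_linkBlock_eq (hM : 2 ≤ M) (t Δ : ℝ) (c : Fin 2 → Fin M) (e : Fin 2) :
    (HartreeFock.sdwState 2 (M * 2) t Δ).submatrix
        (fun a : Orb (Fin 2 ×ₗ FermionTorus 2 2) => orb (linkEmb hM c e (ofLex a).1) (ofLex a).2)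
        (fun a : Orb (Fin 2 ×ₗ FermionTorus 2 2) => orb (linkEmb hM c e (ofLex a).1) (ofLex a).2) =
      (HartreeFock.sdwState 2 (M * 2) t Δ).submatrix
        (fun a : Orb (Fin 2 ×ₗ FermionTorus 2 2) => orb (linkEmb hM 0 e (ofLex a).1) (ofLex a).2)
        (fun a : Orb (Fin 2 ×ₗ FermionTorus 2 2) => orb (linkEmb hM 0 e (ofLex a).1) (ofLex a).2) := by
  have hL : Even (M * 2) := ⟨M, (Nat.mul_two M)⟩
  ext a b
  simp only [submatrix_apply]
  rw [show c = 0 + c from (zero_add c).symm, linkSite_add, linkSite_add,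
    sdwState_orb_siteTranslate_two_nsmul hL]

omit [NeZero M] in
/-- A sum over `α × β` of a function not depending on the first factor. [folklore] -/
theorem sum_prod_eq_card_smul_of_fst_indep {α β N : Type*} [Fintype α] [Fintype β] [AddCommMonoid N]
    (a₀ : α) (G : α × β → N) (h : ∀ a b, G (a, b) = G (a₀, b)) :
    ∑ ℓ, G ℓ = Fintype.card α • ∑ b, G (a₀, b) := by
  rw [Fintype.sum_prod_type]
  simp_rw [h]
  rw [Finset.sum_const, Finset.card_univ]

/-! ### §3. The LUC bound and its thermodynamic limit -/

/-- **The plaquette local-unitary-cluster bound on the torus `(ℤ/2M)²`** (`M ≥ 2`, real `t, U`,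
`Δ ≠ 0`, `u` a particle-number conserving unitary of the plaquette Fock space):
`E_{(ℤ/2M)²}(t,U; 4M²) ≤ M² · Re [ F_cell + F_link,0 + F_link,1 ]`, where, with `γ = sdwState` the
spin-density-wave one-particle density matrix (gap parameter `Δ`) and `V = Γ(inlCell)u · Γ(inrCell)u`,
`F_cell = Σ_{s,t} (uᴴ H_plaq u)_{st} slaterRDM(γ|_{cell 0}) s t` and
`F_link,e = Σ_{s,t} (Vᴴ T_e V)_{st} slaterRDM(γ|_{link 0,e}) s t`. All plaquette terms coincide by the
even-translation invariance of `γ`. [cite: BachLiebSolovej1994, eq. (2c.36)] -/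
theorem groundEnergyAt_le_luc (hM : 2 ≤ M) (t U : ℝ) {Δ : ℝ} (hΔ : Δ ≠ 0)
    (u : Matrix (Finset (Orb (FermionTorus 2 2))) (Finset (Orb (FermionTorus 2 2))) ℂ)
    (hu : uᴴ * u = 1) (huN : Commute totalNumberOp u) :
    groundEnergyAt (fermionTorusGraph 2 (M * 2)) t U ((M * 2) ^ 2) ≤
      (M : ℝ) ^ 2 *
        ((∑ s : Finset (Orb (FermionTorus 2 2)), ∑ s' : Finset (Orb (FermionTorus 2 2)),
            (uᴴ * hamiltonian plaquetteGraph t U * u) s s' *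
              HartreeFock.slaterRDM ((HartreeFock.sdwState 2 (M * 2) t Δ).submatrix
                (fun a : Orb (FermionTorus 2 2) => orb (cellEmb (0 : Fin 2 → Fin M) (ofLex a).1) (ofLex a).2)
                (fun a : Orb (FermionTorus 2 2) => orb (cellEmb (0 : Fin 2 → Fin M) (ofLex a).1) (ofLex a).2)) s s') +
          ∑ e : Fin 2, ∑ s : Finset (Orb (Fin 2 ×ₗ FermionTorus 2 2)), ∑ s' : Finset (Orb (Fin 2 ×ₗ FermionTorus 2 2)),
            ((fermionEmbed inlCell u * fermionEmbed inrCell u)ᴴ * hamiltonian (linkGraph e) t 0 *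
                (fermionEmbed inlCell u * fermionEmbed inrCell u)) s s' *
              HartreeFock.slaterRDM ((HartreeFock.sdwState 2 (M * 2) t Δ).submatrix
                (fun a : Orb (Fin 2 ×ₗ FermionTorus 2 2) => orb (linkEmb hM 0 e (ofLex a).1) (ofLex a).2)
                (fun a : Orb (Fin 2 ×ₗ FermionTorus 2 2) => orb (linkEmb hM 0 e (ofLex a).1) (ofLex a).2)) s s').re := by
  have hL3 : 3 ≤ M * 2 := by omega
  have hLe : Even (M * 2) := ⟨M, Nat.mul_two M⟩
  have htr : (HartreeFock.sdwState 2 (M * 2) t Δ).trace = (((M * 2) ^ 2 : ℕ) : ℂ) :=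
    HartreeFock.trace_sdwState hL3 hLe t hΔ
  have h := groundEnergyAt_le_dressed hM t U (HartreeFock.isHermitian_sdwState hL3 hLe t hΔ)
    (HartreeFock.sdwState_mul_self hL3 hLe t hΔ) htr (fun _ => u) (fun _ => hu) (fun _ => huN)
  simp only [sdwState_cellBlock_eq t Δ] at h
  rw [Finset.sum_const, Finset.card_univ, sum_prod_eq_card_smul_of_fst_indep (0 : Fin 2 → Fin M),
    Fintype.card_fun, Fintype.card_fin] at h
  swap
  · intro c e
    simp only [sdwState_linkBlock_eq hM t Δ]
  have key : ∀ (n : ℕ) (z w : ℂ), (n • z + n • w).re = (n : ℝ) * (z + w).re := by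
    intro n z w
    simp [nsmul_eq_mul, Complex.mul_re, mul_add]
  rw [key] at h
  push_cast at h
  exact h

/-- **Thermodynamic limit of the plaquette-LUC bound.** For `U ≥ 0`, `M ≥ 2`, `Δ ≠ 0` and a
particle-number conserving plaquette unitary `u`, the ground-state energy density of the square-lattice
Hubbard model at half filling satisfies `e(t,U; 1) ≤ Re F / 4 + 8|t|/M` with the finite window
expression `F` of `groundEnergyAt_le_luc` (tiling bound `ThermodynamicLimit.energyDensity2D_le` at
`L = 2M`). [cite: Ruelle1969, §3.3][cite: BachLiebSolovej1994, eq. (2c.36)] -/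
theorem energyDensity2D_le_luc (hM : 2 ≤ M) (t : ℝ) {U : ℝ} (hU : 0 ≤ U) {Δ : ℝ} (hΔ : Δ ≠ 0)
    (u : Matrix (Finset (Orb (FermionTorus 2 2))) (Finset (Orb (FermionTorus 2 2))) ℂ)
    (hu : uᴴ * u = 1) (huN : Commute totalNumberOp u) :
    ThermodynamicLimit.energyDensity2D t U 1 ≤
      ((∑ s : Finset (Orb (FermionTorus 2 2)), ∑ s' : Finset (Orb (FermionTorus 2 2)),
            (uᴴ * hamiltonian plaquetteGraph t U * u) s s' *
              HartreeFock.slaterRDM ((HartreeFock.sdwState 2 (M * 2) t Δ).submatrix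
                (fun a : Orb (FermionTorus 2 2) => orb (cellEmb (0 : Fin 2 → Fin M) (ofLex a).1) (ofLex a).2)
                (fun a : Orb (FermionTorus 2 2) => orb (cellEmb (0 : Fin 2 → Fin M) (ofLex a).1) (ofLex a).2)) s s') +
          ∑ e : Fin 2, ∑ s : Finset (Orb (Fin 2 ×ₗ FermionTorus 2 2)), ∑ s' : Finset (Orb (Fin 2 ×ₗ FermionTorus 2 2)),
            ((fermionEmbed inlCell u * fermionEmbed inrCell u)ᴴ * hamiltonian (linkGraph e) t 0 *
                (fermionEmbed inlCell u * fermionEmbed inrCell u)) s s' *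
              HartreeFock.slaterRDM ((HartreeFock.sdwState 2 (M * 2) t Δ).submatrix
                (fun a : Orb (Fin 2 ×ₗ FermionTorus 2 2) => orb (linkEmb hM 0 e (ofLex a).1) (ofLex a).2)
                (fun a : Orb (Fin 2 ×ₗ FermionTorus 2 2) => orb (linkEmb hM 0 e (ofLex a).1) (ofLex a).2)) s s').re / 4 +
        8 * |t| / M := by
  have hLpos : (0 : ℝ) < M := by exact_mod_cast (lt_of_lt_of_le (by norm_num) hM)
  have hTL := ThermodynamicLimit.energyDensity2D_le t hU (L := M * 2) (by omega) (m := 2 * M ^ 2)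
    (by nlinarith)
  have hdens : ((2 * (2 * M ^ 2) : ℕ) : ℝ) / ((M * 2 : ℕ) : ℝ) ^ 2 = 1 := by
    rw [div_eq_one_iff_eq (by positivity)]; push_cast; ring
  rw [hdens, show 2 * (2 * M ^ 2) = (M * 2) ^ 2 by ring, ← groundEnergyAt_fermionTorusGraph_two] at hTL
  have hluc := groundEnergyAt_le_luc hM t U hΔ u hu huN
  refine hTL.trans ?_
  have h16 : 16 * |t| / ((M * 2 : ℕ) : ℝ) = 8 * |t| / M := by
    push_cast; field_simp; ring
  rw [h16, add_le_add_iff_right, div_le_iff₀ (by positivity)]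
  refine hluc.trans (le_of_eq ?_)
  push_cast
  ring

end PlaquetteLUC

end Literature.MathematicalPhysics.QuantumLattice
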